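import Summits.BirchSwinnertonDyer.BirchSwinnertonDyer.Theorems.SmallImageMuTransferMuTransferOfZetaSideAnyImage
import Literature.NumberTheory.EllipticCurves.IwasawaAlgebraProofs
import HarnessLib

/-!
# Junk-immunity of the crux `MuTransfer` (stmt-BirchSwinnertonDyer-19629) modulo the zeta side: the kernel
# proves `X(E/ℚ_∞)_(p) = 0`, hence `X(E/ℚ_∞)` is Λ-TORSION and FINITELY GENERATED OVER ℤ_p — not merely
# the tree's `μ = 0`, whose junk value is `0` on non-torsion modules

Cell `bsd-smallim` (rung K6 of `BirchSwinnertonDyer`, class X9), seat `bsd-line-k6-p2` gen 3 (D-0154 KEY (146)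
row 9; line `f1_fine` of `Cruxes/MuTransfer`).  HONEST FRAMING: proves no case of BSD and closes no item — 19629
stays OPEN by design; everything here is CONDITIONAL on the ONE named published construction fact
ZS = `Kato2004.exists_zetaSideInputs` (the gate records `conditional-result`).  PARTITION (D-0054): X9 (A4) and
every odd good-ordinary irreducible row — types-the-object-of; closes NONE; bears_on K6 item 19629 (shared PrintX9).

## Why (the audit question this file answers in the kernel)

The crux concludes `D.mu = 0`, and the tree's `SelmerDualData.mu := muInvariant p D.X` is
`(length_(p) X).toNat`, whose value is the JUNK `0` when the local length is infinite (module docstring of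
`IwasawaAlgebra`, `muInvariant`): on a non-torsion `X(E/ℚ_∞)` the conclusion `μ = 0` would be vacuous.  A
faithfulness audit of the chain `ZS ⟹ MuTransfer` (gen 2, `smallImageMuTransfer_MuTransfer_of_zetaSide`,
p610284) must therefore check that the proof does not run through the junk branch.  It does not: the
bookkeeping `ZetaSideInputs.lengthAt_X_le_lengthAt_fine` bounds the GENUINE local length
`length_(p) X(E/ℚ_∞) ≤ length_(p) X₀(E/ℚ_∞)`, and the kernel `μ`-core makes the right side `0`.  This file
exposes that intermediate by name and draws the two junk-free consequences:

* `smallImageMuTransfer_lengthAt_selmerDual_eq_zero_of_irr_of_zetaSide` — modulo ZS: for `E/ℚ` on a globally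
  minimal model, `p` an ODD good ordinary prime with `E[p]` irreducible (any image), `f` a newform of `E` with
  one `p`-adic unit coefficient of `L_p(f, α)`, and every cyclotomic datum: `length_(p) X(E/ℚ_∞) = 0`, i.e.
  `X(E/ℚ_∞) ⊗_Λ Λ_(p) = 0`;
* `smallImageMuTransfer_selmerDual_isTorsion_of_irr_of_zetaSide` — hence `X(E/ℚ_∞)` is a TORSION `Λ`-module
  (`D.IsTorsion`; every `x` is killed by some `s ∉ (p)`, and `Λ` is a domain) — in print this is Kato's
  Thm. 17.4 (1) (via Thm. 12.4 and Rohrlich); here, in the `μ(L_p) = 0` case, it falls out of the zeta side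
  and the `μ`-argument alone;
* `smallImageMuTransfer_selmerDual_moduleFinite_padicInt_of_irr_of_zetaSide` — and `X(E/ℚ_∞)` is FINITELY
  GENERATED OVER `ℤ_p` (tree `finite_of_lengthAt_eq_zero`, Weierstrass division; Washington §13.2), which is
  Greenberg's formulation of `μ = 0` (LNM 1716 §1, Conj. 1.11: "`Sel_E(ℚ_∞)_p[p]` finite ⟺ `X` is a finitely
  generated `ℤ_p`-module", for `Λ`-cotorsion Selmer) — the statement a reader recognises, independent of the
  tree's `toNat` convention.

So the conditional closer of item 19629 proves, modulo ZS, the real theorem (torsion ∧ `μ = 0` ∧ f.g./`ℤ_p`),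
not an artefact of a junk value.  The proof of the first theorem is gen 2's assembly VERBATIM up to its last
line (image facts (SC)/(IF) for every irreducible `E[p]` at odd `p`, §2 of the imported file; GV Prop. 3.7
integrality; `ZetaSideInputs.exists_isEulerSystemClass_notMem`; cell `bsd-potss`' unconditional core
`CoreAssembly.coreIrr_anyReduction_holds`; `length_(p) X₀ = 0`); nothing new is asserted.

References: K. Kato, Astérisque 295 (2004) Thm. 12.6, Ex. 13.3, (14.9.3), Thm. 16.6 (2), 17.4 (1), Prop. 17.11,
§17.13 [Kato2004Asterisque]; R. Greenberg, LNM 1716 (1999) §1 (p. 60) and Conj. 1.11 [GreenbergLNM1716];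
R. Greenberg, V. Vatsal, Invent. Math. 142 (2000) Prop. 3.7 [GreenbergVatsal2000]; L. Washington, *Introduction
to Cyclotomic Fields*, §13.2 [Washington1997].
-/

-- the summit and its single problem are both named `BirchSwinnertonDyer` (registry layout D-0017)
set_option linter.dupNamespace false
set_option autoImplicit false

noncomputable section

open scoped Classical MatrixGroups ModularForm NumberField
open CongruenceSubgroup WeierstrassCurve Field IsDedekindDomain
open Literature.NumberTheory.GaloisRepresentations
open Literature.NumberTheory.EllipticCurves Literature.NumberTheory.EllipticCurves.ModularForms
open Literature.NumberTheory.EllipticCurves.Kato2004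
open Literature.NumberTheory.EllipticCurves.Kato2004.EulerSystemValues
open Literature.NumberTheory.EllipticCurves.Rank1Residual
open Summit.BirchSwinnertonDyer.BirchSwinnertonDyer.Rank1Residual

namespace Summit.BirchSwinnertonDyer.BirchSwinnertonDyer.Theorems

/-! ## §1 `length_(p) X(E/ℚ_∞) = 0` modulo the zeta side -/

/-- **`X(E/ℚ_∞)_(p) = 0` at every ODD good ordinary prime with `E[p]` irreducible — any image — given one unit
coefficient of `L_p(f, α)`, modulo the ZETA SIDE of Kato's package ALONE** (ZS = `Kato2004.exists_zetaSideInputs`).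
This is the genuine local-length statement behind gen 2's `smallImageMuTransfer_mu_eq_zero_of_irr_of_zetaSide`
(whose `D.mu` is `(length_(p) X).toNat`): the same assembly — image facts (SC)/(IF) for an irreducible `E[p]` at
odd `p`, GV Prop. 3.7 (`ι G₁ = L_p`, `G₁ ∉ (p)` from the certificate), a GENUINE Euler-system class outside `p𝐇¹`
(`ZetaSideInputs.exists_isEulerSystemClass_notMem`), cell `bsd-potss`' unconditional core
(`CoreAssembly.coreIrr_anyReduction_holds`: `Sel₀(ℚ_∞, E[p^∞])[p]` is killed by a power of `T`), so
`length_(p) X₀ = 0`; and the bookkeeping `ZetaSideInputs.lengthAt_X_le_lengthAt_fine` ((17.13.1) exact at `P`,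
Prop. 17.11 injective, (14.9.3)) gives `length_(p) X ≤ length_(p) X₀ = 0`.  Conditional on ZS only.
[cite: Kato2004Asterisque, Thm. 12.6 (p. 222), Ex. 13.3 (p. 225), (14.9.3) (p. 240), Thm. 16.6 (2) (p. 271), Prop. 17.11 (p. 277) and §17.13 (pp. 279–280)]
[cite: GreenbergVatsal2000, Prop. 3.7] -/
theorem smallImageMuTransfer_lengthAt_selmerDual_eq_zero_of_irr_of_zetaSide (hZS : exists_zetaSideInputs) :
    ∀ (W : WeierstrassCurve ℚ) [W.IsElliptic] [W.IsGloballyMinimal] (p : ℕ) [Fact p.Prime]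
      {N : ℕ} [NeZero N] (f : CuspForm (Gamma0 N) 2),
      p ≠ 2 → W.HasGoodReductionAtPrime p → ¬ (p : ℤ) ∣ W.frobeniusTrace p →
      W.HasIrreducibleModPGaloisRep p → IsNewformOf W f →
      (∃ n : ℕ, ‖PowerSeries.coeff n (padicLFunction f (unitRoot W p : ℚ_[p]))‖ = 1) →
      ∀ (κ : ZpExtension ℚ p) (γ : absoluteGaloisGroup ℚ),
        κ.IsCyclotomic → κ.IsTopGenerator γ → IsCyclotomicVariable p γ →
        ∀ D : W.SelmerDualData κ γ,
          Module.lengthAt (IwasawaAlgebra p) D.X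
            ⟨IwasawaAlgebra.augIdealP p, IwasawaAlgebra.isPrime_augIdealP_holds p⟩ = 0 := by
  intro W _ _ p _ N _ f hp2 hgood hap hirr hf hcert κ γ hκ hγ hγ' D
  haveI : ContinuousSMul ℤ_[p] (W.tateModule p) := TateModule.continuousSMul_padicInt
  haveI : Module.Free ℤ_[p] (W.tateModule p) := W.module_free_tateModule_holds p
  haveI : Module.Finite ℤ_[p] (W.tateModule p) := W.module_finite_tateModule_holds p
  have hord : IsOrdinaryAt W p := ⟨hgood, hap⟩
  -- the image facts (SC)/(IF), onto or not (§2 of the imported file)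
  have hSC := exists_smul_eq_val_smul_of_irreducible_of_ne_two W p hp2 hirr
  have hIF := forall_normal_index_ne_of_irreducible_of_ne_two W p hp2 hirr
  -- the pinned modules: `𝐇¹_Γ(T_pW)` and the dual fine Selmer group `X₀(E/ℚ_∞)`
  obtain ⟨I⟩ := nonempty_iwasawaH1Data_holds W p κ γ hκ hγ
  obtain ⟨Y⟩ := W.nonempty_fineSelmerDualData κ hγ
  -- `X(E/ℚ_∞)` is finitely generated over `Λ` for the cyclotomic `κ` (tree theorem)
  haveI : Module.Finite (IwasawaAlgebra p) D.X :=
    WeierstrassCurve.SelmerDualData.module_finite_of_isCyclotomic W κ hκ D hγ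
  -- the zeta-side package
  obtain ⟨K⟩ := hZS W p f κ γ hp2 hord hκ hγ hγ' hf I D Y
  haveI : Module.Finite (IwasawaAlgebra p) Y.X := Module.Finite.of_surjective K.π K.π_surjective
  -- `L_p ∈ Λ` (GV Prop. 3.7) and the certificate: `G₁ ∉ (p)`
  obtain ⟨G₁, hG₁⟩ := exists_iwasawaToPowerSeries_eq_padicLFunction hp2 hord hf hirr
  have hμL : G₁ ∉ IwasawaAlgebra.augIdealP p := not_mem_augIdealP_of_norm_coeff_eq_one hG₁ hcert
  -- §6 (i) with the span clause: some GENUINE Euler-system class is not divisible by `p`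
  obtain ⟨s, hs, hsp⟩ := K.exists_isEulerSystemClass_notMem hirr hG₁ hμL
  -- the core under image facts (cell bsd-potss, unconditional, any reduction, odd prime)
  obtain ⟨J, hJ⟩ := CoreAssembly.coreIrr_anyReduction_holds W p κ γ I hp2 hirr hSC hIF hκ hγ ⟨s, hs, hsp⟩
  haveI : Finite (Y.X ⧸ (IwasawaAlgebra.augIdealP p • (⊤ : Submodule (IwasawaAlgebra p) Y.X))) :=
    Y.finite_quotient_augIdealP_of_finite_pTorsion
      (W.finite_fineSelmerInfty_pTorsion_of_forall_iterate_eq_zero κ hγ hJ)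
  -- bookkeeping at `𝔭 = (p)`: `length X_𝔭 ≤ length X₀_𝔭 = 0`
  let 𝔭 : PrimeSpectrum (IwasawaAlgebra p) :=
    ⟨IwasawaAlgebra.augIdealP p, IwasawaAlgebra.isPrime_augIdealP_holds p⟩
  have hY0 : Module.lengthAt (IwasawaAlgebra p) Y.X 𝔭 = 0 :=
    Summit.BirchSwinnertonDyer.BirchSwinnertonDyer.Rank1Residual.KatoMuSkeleton.lengthAt_eq_zero_of_finite_quotient_p
      (M := Y.X) 𝔭 rfl
  exact le_antisymm ((K.lengthAt_X_le_lengthAt_fine hirr hG₁ hμL 𝔭 rfl).trans hY0.le) bot_le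

/-! ## §2 `X(E/ℚ_∞)` is `Λ`-torsion -/

/-- **`X(E/ℚ_∞)` is a TORSION `Λ`-module (`D.IsTorsion`) at every ODD good ordinary prime with `E[p]` irreducible
— any image — given one unit coefficient of `L_p(f, α)`, modulo the zeta side ALONE.**  From §1: `X_(p) = 0`
means every `x ∈ X` is killed by some `s ∉ (p)`; such an `s` is non-zero, hence a non-zero-divisor of the
domain `Λ = ℤ_p⟦T⟧`.  In print the torsion statement is Kato's Thm. 17.4 (1) (through Thm. 12.4); here, in the
`μ(L_p) = 0` case, it is a by-product of the `μ`-argument.  This is the kernel certificate that gen 2's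
conclusion `D.mu = 0` is NOT the junk value of `muInvariant` on a non-torsion module.  Conditional on ZS only.
[cite: Kato2004Asterisque, Thm. 17.4 (1) (p. 273) and §17.13 (pp. 279–280)] [cite: GreenbergVatsal2000, Prop. 3.7] -/
theorem smallImageMuTransfer_selmerDual_isTorsion_of_irr_of_zetaSide (hZS : exists_zetaSideInputs) :
    ∀ (W : WeierstrassCurve ℚ) [W.IsElliptic] [W.IsGloballyMinimal] (p : ℕ) [Fact p.Prime]
      {N : ℕ} [NeZero N] (f : CuspForm (Gamma0 N) 2),
      p ≠ 2 → W.HasGoodReductionAtPrime p → ¬ (p : ℤ) ∣ W.frobeniusTrace p →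
      W.HasIrreducibleModPGaloisRep p → IsNewformOf W f →
      (∃ n : ℕ, ‖PowerSeries.coeff n (padicLFunction f (unitRoot W p : ℚ_[p]))‖ = 1) →
      ∀ (κ : ZpExtension ℚ p) (γ : absoluteGaloisGroup ℚ),
        κ.IsCyclotomic → κ.IsTopGenerator γ → IsCyclotomicVariable p γ →
        ∀ D : W.SelmerDualData κ γ, D.IsTorsion := by
  intro W _ _ p _ N _ f hp2 hgood hap hirr hf hcert κ γ hκ hγ hγ' D
  have hX := smallImageMuTransfer_lengthAt_selmerDual_eq_zero_of_irr_of_zetaSide hZS W p f hp2 hgood hap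
    hirr hf hcert κ γ hκ hγ hγ' D
  -- `X_(p) = 0`: every element is killed by some `s ∉ (p)`
  rw [Module.lengthAt_eq_zero_iff, LocalizedModule.subsingleton_iff] at hX
  intro x
  obtain ⟨s, hs, hsx⟩ := hX x
  have hs0 : s ≠ 0 := fun h0 ↦ hs (h0 ▸ (IwasawaAlgebra.augIdealP p).zero_mem)
  exact ⟨⟨s, mem_nonZeroDivisors_of_ne_zero hs0⟩, hsx⟩

/-! ## §3 `X(E/ℚ_∞)` is finitely generated over `ℤ_p` (Greenberg's form of `μ = 0`) -/

/-- **`X(E/ℚ_∞)` is FINITELY GENERATED OVER `ℤ_p` at every ODD good ordinary prime with `E[p]` irreducible — any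
image — given one unit coefficient of `L_p(f, α)`, modulo the zeta side ALONE** (`Module.Finite ℤ_[p]` of
`RestrictScalars ℤ_[p] Λ X`, the tree's idiom for Greenberg's statement).  From §1 (`X_(p) = 0`, `X` finitely
generated over `Λ`) by the tree's Weierstrass-division lemma `finite_of_lengthAt_eq_zero` (Washington §13.2).
This is Greenberg's formulation of the `μ = 0` conjecture for `E[p]` irreducible (LNM 1716 §1 p. 60 and Conj.
1.11: for `Λ`-cotorsion `Sel_E(ℚ_∞)_p`, `μ = 0` iff `X` is a finitely generated `ℤ_p`-module iff `Sel_E(ℚ_∞)_p[p]`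
is finite), which does not depend on any `toNat` convention.  Conditional on ZS only; nothing asserted.
[cite: GreenbergLNM1716, §1 (p. 60) and Conj. 1.11] [cite: Washington1997, §13.2]
[cite: Kato2004Asterisque, §17.13 (pp. 279–280)] -/
theorem smallImageMuTransfer_selmerDual_moduleFinite_padicInt_of_irr_of_zetaSide
    (hZS : exists_zetaSideInputs) :
    ∀ (W : WeierstrassCurve ℚ) [W.IsElliptic] [W.IsGloballyMinimal] (p : ℕ) [Fact p.Prime]
      {N : ℕ} [NeZero N] (f : CuspForm (Gamma0 N) 2),
      p ≠ 2 → W.HasGoodReductionAtPrime p → ¬ (p : ℤ) ∣ W.frobeniusTrace p →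
      W.HasIrreducibleModPGaloisRep p → IsNewformOf W f →
      (∃ n : ℕ, ‖PowerSeries.coeff n (padicLFunction f (unitRoot W p : ℚ_[p]))‖ = 1) →
      ∀ (κ : ZpExtension ℚ p) (γ : absoluteGaloisGroup ℚ),
        κ.IsCyclotomic → κ.IsTopGenerator γ → IsCyclotomicVariable p γ →
        ∀ D : W.SelmerDualData κ γ,
          Module.Finite ℤ_[p] (RestrictScalars ℤ_[p] (IwasawaAlgebra p) D.X) := by
  intro W _ _ p _ N _ f hp2 hgood hap hirr hf hcert κ γ hκ hγ hγ' D
  have hX := smallImageMuTransfer_lengthAt_selmerDual_eq_zero_of_irr_of_zetaSide hZS W p f hp2 hgood hap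
    hirr hf hcert κ γ hκ hγ hγ' D
  haveI : Module.Finite (IwasawaAlgebra p) D.X :=
    WeierstrassCurve.SelmerDualData.module_finite_of_isCyclotomic W κ hκ D hγ
  -- the compatible `ℤ_p`-structure on `X` (= the one of `RestrictScalars ℤ_[p] Λ X`, by `Module.compHom`)
  letI : Module ℤ_[p] D.X := Module.compHom D.X (algebraMap ℤ_[p] (IwasawaAlgebra p))
  haveI : IsScalarTower ℤ_[p] (IwasawaAlgebra p) D.X := IsScalarTower.of_compHom ℤ_[p] _ D.X
  exact finite_of_lengthAt_eq_zero p D.X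
    ⟨IwasawaAlgebra.augIdealP p, IwasawaAlgebra.isPrime_augIdealP_holds p⟩ rfl hX

end Summit.BirchSwinnertonDyer.BirchSwinnertonDyer.Theorems

end
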